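import Literature.MathematicalPhysics.QuantumFieldTheory.Balaban1983to89.T4TowerRateComposition
import Literature.MathematicalPhysics.QuantumFieldTheory.Balaban1983to89.T4RateLiaison
import Literature.MathematicalPhysics.QuantumFieldTheory.Balaban1983to89.B14
import Literature.MathematicalPhysics.QuantumFieldTheory.Dimock2015.AnalyticLipschitz
/-!
# `Balaban1983to89.T4TowerRateDischarge` — TERM-WISE MATCHING ALONG THE TOWER, II: the wall items of
`T4TowerRateComposition` DISCHARGED to located inputs — the Cauchy step for the regular terms (analytic margin ⇒
Lipschitz-in-the-background), the polynomial growth of its constant from the printed radius shape (2.28) and the printed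
flow (0.31), the composition WITHOUT any order among the rates, and the seams to the sibling nodes' typed outputs BY NAME
(NE3 = `T4EtaRateMin.LocalRate` through `T4RateLiaison.GaugeDominated`; node U2 = `T4CauchySum.InjectedRate … disc` =
the conclusion of `T4CouplingMatching.injectedRate_of_runs_eventual`) (cell `pub-balaban`, T4-DAG §5 node U5 / estimate
NE7, technique "term-wise"; record `t4/T4-EST-NE7-P1.md` v2)

HONEST FRAMING (cell `pub-balaban`, T4-DAG PAGE 1).  The cell's T4 target is the existence AND uniqueness of the continuum
limit of Bałaban's unit-scale averaged loop expectations on a FINITE torus, rung (B)+1 of the cell's ladder — strictly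
beyond ultraviolet stability ([Balaban1989LargeFieldII] Thm 1 p. 355); it is NOT infinite volume, NOT the Yang–Mills mass
gap and NOT the Clay problem.  Estimate NE7 (matching of the two runs' dressed partition functions MODULO CONSTANTS with a
summable radius) is NOT PRINTED anywhere; this module does NOT prove it, and none of the cell estimates NE3, NE4, NE5, NE9
it consumes is printed either — they enter as the HYPOTHESIS SHAPES of the imported modules, by name.  What is
kernel-checked here, decl by decl:
* §1 THE CAUCHY STEP FOR THE REGULAR TERMS (`lipBackground_of_analyticMargin`): an analytic extension of
  `U ↦ E^{(j)}(X; g, U)` to a complex normed space of background data, bounded by `E₀e^{−κd_j(X)}` on a domain containing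
  the closed `ϱ(g, j)`-balls about the (embedded) admissible backgrounds, gives `T4OutputRate.LipBackground` with the
  constant family `4E₀/ϱ(g, j)` — by the tree's `Dimock2015.norm_sub_le_of_margin` (Cauchy estimate on a shrunk polydisc,
  template [DimockYuan2024GNFlow] Thm 4).  This is the step the docstring of `T4OutputRate.LipBackground` and
  `T4TowerRateComposition.PolyLipGrowth` declare "NOT carried out" (cell GAPS G-t4-U3-2, G-ne7p1-2); its boundary-term twin
  is `T4BoundaryCarrier.lipBackgroundFl_of_analyticMargin`; the same data give `T4OutputRate.DecayBound`
  (`decayBound_of_analyticMargin`).  The INPUTS (analyticity with the margin, the sup bound) stay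
  hypotheses: (2.27)(ii)/(iv) p. 259 of [Balaban1988Convergent] print analyticity on `U^c_j(X, α_{0,j}, α_{1,j})` and the
  bound (I.1.18) for ONE run; a quantitative margin of the real admissible backgrounds inside that space is NOT PRINTED.
* §2 THE MARGIN IN COUPLING UNITS ⇒ POLYNOMIAL GROWTH: the printed radii (2.28) `α_{·,j} = g_jC(log g_j^{−2})^q` are
  `≥ C·g_j` as soon as `g_j² ≤ e^{−1}` (`alphaJ_ge_mul`, `couplingMargin_alphaJ`, over the tree's `B14.alphaJ`); the
  MARGIN READING (MR) "margin `≥ c₀·g_j`" (NOT PRINTED; an explicit `∀`-hypothesis, no definition) and the UPPER half of the printed discrete flow (0.31) p. 259 of [Balaban1987RG1]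
  (tree `Step.Discrete031`: `1/g_j² ≤ 1/g² + β′(K − j)`, `invSq_le_of_discrete031`) — or equally the first member of the
  printed flow inequality (2.6) p. 255 of [Balaban1988Convergent] (tree `B14.FlowIneq26`, `invSq_le_of_flowIneq26`) — hence
  `1/g_j ≤ (1/g + √β′)(K − j + 1)` (`inv_le_of_invSq_le`), give `T4TowerRateComposition.PolyLipGrowth` with exponent `q = 1`
  and the explicit constant `(4E₀/c₀)(1/g + √β′)` (`polyLipGrowth_of_couplingMargin`, `…_discrete031`, `…_flowIneq26`) —
  the hypothesis (M3′) of the record's wall, reduced to the margin reading.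
* §3 NO ORDER AMONG THE RATES: `uRateUpTo_tower_anyRate` — memory rate `ω` (fading memory), coupling rate `θc` (node U2),
  argument-bracket rate `θa` (closeness ⊛ growth) and NE5's rate `θ₅` are all worsened to ANY common `θ′` with
  `max(ω, θc) < θ′`, `θa, θ₅ ≤ θ′`, with a constant UNIFORM IN THE CUTOFF `K` (`T4TowerRateComposition.historySum_le_rate_of_lt`
  absorbs the factor `j`; `ne5_mono` worsens NE5).  The separation `ω < θ` of `T4TowerRateComposition.uRateUpTo_tower`
  (record wall (M2), GAPS G-ne7p1-1) is therefore never needed: rates can always be worsened, and §5–§6 of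
  `T4TowerRateComposition` only need SOME rate `< 1` (`exists_commonRate_lt_one`).
* §4 THE SEAMS BY NAME and the END-TO-END COMPOSITION: `closeness_of_localRate` (NE3 in the minimal η-rate currency
  `T4EtaRateMin.LocalRate R C₃ θ₃` + the liaison `T4RateLiaison.GaugeDominated` ⇒ the closeness `C₃θ₃^K` of the two runs'
  backgrounds at cutoff `K`, = `T4RateLiaison.gauge_le_of_localRate`); `uRateUpTo_of_nodes` (NE9 + fading memory +
  Lipschitz-in-U with polynomial growth + NE5 + NE3/liaison + node U2's OUTPUT `InjectedRate Cd 0 θc disc` on the printed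
  box `]0, γ]` ⇒ FOR EVERY CUTOFF `K` the node-U3 rate `URateUpTo K` on run A's re-indexed couplings `g K` against run B's
  `i ↦ g (K+1) (i+1)`, admissible data `R.dom`, with ONE constant `a + C₉γ³Cd·θ′/(θ′ − max(ω,θc)) + C₅`);
  `uRateUpTo_of_spine` (the same with node U2's INPUTS in place of its output — the RG equations (0.20) with
  history-dependent β-functions `FlowStep.RGEqH`, the box, the infrared pin `g K K = g`, NE4 `ScaleShiftRate`, NE9-β
  `HistLipschitz` + `FadingMemory`, and the asymptotic-freedom LOWER BOUND `EventualLowerH b γ k₀ β` on the β-functions —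
  NOT PRINTED, the conditional behind (0.31) on the cell's BetaPertH road, EXPLICIT as a binder — through
  `T4CouplingMatching.injectedRate_of_runs_eventual`); `uRateUpTo_of_margin` (the fully located chain: §1's analytic-margin
  data + §2's margin in coupling units and (0.31) + the node shapes ⇒ the same conclusion, Lipschitz family `4E₀/ϱ`).
* §5 THE HOOK TO NODE U5b with a `K`-UNIFORM constant: `factorLogRatio_smallFieldE_tower` (the node-U5b statement for the
  small-field kind on every cutoff-`K` ledger, constant independent of `K`) and `crossoverDeltaPoly_zero` (so §5–§6 of
  `T4TowerRateComposition` apply with `p = 0`: no polynomial loss is incurred by the term-wise composition at all).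
* §6 NON-VACUITY: toy readings/backgrounds/couplings meeting `LocalRate`, `GaugeDominated`, `InjectedRate … disc`, the box
  and `PolyLipGrowth` simultaneously with `T4TowerRateComposition.toy_nonvacuous`'s functionals, and the conclusion of
  `uRateUpTo_of_nodes` instantiated on them (the hypothesis set of §4 is jointly satisfiable).
Every cell estimate enters as a HYPOTHESIS, never as a fact; no conditional ((B), (B^μ), BetaPertH) is hidden in a
definition — where one enters (§4 `uRateUpTo_of_spine`: the lower bound `EventualLowerH` on the full β-functions and the
flow (0.31)/(2.6), which in Bałaban's model rest on the unpublished Theorem 2 of [Balaban1987RG1] — the cell's BetaPertH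
road, T4-DAG H0/H3) it is a named binder.

CITATION HEADER (printed context only; quotations as transcribed in the cell's citation register `t4/CITED-FACTS-T4.md` v1
(entries F-T4-13, F-T4-14, F-T4-29) and in the headers of the imported tree modules `T4OutputRate`, `T4CouplingMatching`,
`B14`, `Step`, which read them from the cell's page store).
* [Balaban1988Convergent] T. Bałaban, *Convergent renormalization expansions for lattice gauge theories*, Commun. Math.
  Phys. 119 (1988) 243–285, p. 259 (2.27) and properties (i)–(iv): «(ii) there exists an analytic function
  𝐄^{(j)}(X, (𝐔,𝐉), z) of the variables (𝐔,𝐉) ∈ U^c_j(X, α_{0,j}, α_{1,j}), which is an extension of this term, i.e., the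
  equality (I.1.9) is satisfied; (iii) … ; (iv) it satisfies the inequality (I.1.18).»; (2.28): «The numbers α_{0,j}, α_{1,j}
  in the symbol of the space are given by α_{0,j} = g_jC₀(log g_j^{−2})^{q₀}, α_{1,j} = g_jC₁(log g_j^{−2})^{q₁}, (2.28)
  where q₀, q₁ are integers greater than 1, C₀, C₁ are sufficiently large positive numbers.» (ONE run; the radii SHRINK
  with g_j — the cell's police rule P4: "any Cauchy-with-margin argument must carry the log-loss 1/α_{·,j}"; §2 carries it
  as the factor 1/g_j, the logarithm only helps); p. 255 (2.6): «The coupling constants g_j satisfy the inequalities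
  g_n ≤ (1 + g_n²β′(n−m))^{1/2} g_m ≤ … , g_m ≤ (1+β₀) g_n, (2.6) where n > m, and β₀ > 0 can be chosen arbitrarily small,
  if g is sufficiently small. The inequalities follow from the renormalization group equations (0.20) [I], and from the
  properties of the β-functions.» (verbatim in the docstring of `B14.FlowIneq26`; a CONSEQUENCE of the flow facts, police
  rule P7 — used in §2 only as an alternative binder to (0.31)).
* [Balaban1987RG1] T. Bałaban, *Renormalization group approach to lattice gauge field theories. I*, Commun. Math. Phys. 109
  (1987) 249–301: p. 263 (1.17)–(1.18) (membership of the real configurations in U^c_j with ABSOLUTE α₀, α₁ in the spaces of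
  [I]; the bound E₀e^{−κd_j(X)}); «It is a C^∞-function of g_{j−1} ∈ [0, γ], (or analytic)» (qualitative); (0.31) p. 259 (the
  two-sided discrete flow, tree `Step.Discrete031`; only its UPPER half is used in §2); Theorem 2 p. 259 «A proof of this
  theorem … will be given in a separate paper» (the conditional behind `EventualLowerH`/(0.31) — NEVER used as a result).
* [DimockYuan2024GNFlow] J. Dimock, C. Yuan, *Structural stability of the RG flow in the Gross–Neveu model*, AHP 25 (2024),
  arXiv:2303.07916v3, proof of Thm 4: «The analyticity implies Lipschitz continuity in x_k and it is uniform in t» — the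
  TEMPLATE mechanism of §1 (tree `Dimock2015.AnalyticLipschitz`), printed and proved for THEIR model; nothing of it is
  evidence about Bałaban's.

WHAT IS PROVED is [folklore] throughout (one application of the Cauchy estimate of `Dimock2015.AnalyticLipschitz`, real
inequalities, `Real.log`/`Real.sqrt` monotonicity); nothing is defined — every cell reading is an explicit binder.
Deliberately NOT here: the
weight half of NE7 (sibling seat P2, `T4ShellSuppressionRoute`), the variance route (P3, `T4VarianceMatching`), the shell
estimates NE7b/NE7c, the deviation clause of node U5b (hazard H-U5b-1), and any claim that Bałaban's expansions satisfy
the hypothesis shapes (cell GAPS G-t4-U3-1…3, G-t4-U2-2, G-t4-U5-NE7, G-ne7p1-1…3).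
-/

open Finset Metric

namespace Literature.MathematicalPhysics.QuantumFieldTheory.Balaban1983to89.T4TowerRateDischarge

open T4OutputRate T4TowerRateComposition T4CauchySum
open T4EtaRateMin (Readings LocalRate)
open T4RateLiaison (GaugeDominated gauge_le_of_localRate)

/-! ## §1 The Cauchy step for the regular terms: analytic margin ⇒ Lipschitz-in-the-background -/

section Cauchy

variable {C : Carriers} {E : Type*} [NormedAddCommGroup E] [NormedSpace ℂ E]

/-- **ANALYTIC IN THE BACKGROUND WITH A MARGIN ⇒ LIPSCHITZ IN THE BACKGROUND** (the E-term twin of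
`T4BoundaryCarrier.lipBackgroundFl_of_analyticMargin`).  Inputs, for every admissible coupling sequence `g` and domain `X`
(ALL HYPOTHESES — the printed claims (2.27)(ii)/(iv) p. 259 of [Balaban1988Convergent] concern ONE run and print no
quantitative margin): an embedding `ι` of run-A backgrounds into a complex normed space `E` of background data whose
distance is dominated by the carrier's gauge; a domain `D g X ⊆ E`; an extension `Ec g X : E → ℂ` of `U ↦ E^{(j)}(X; g, U)`,
complex differentiable on `D g X`, bounded there by `E₀e^{−κd(X)}`, agreeing with the real values at embedded backgrounds;
closed balls of radius `ϱ g (scale X) > 0` about embedded backgrounds inside `D g X`.  Output: `LipBackground EA W κ CU`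
with `CU g j = 4E₀/ϱ g j` — by `Dimock2015.norm_sub_le_of_margin`.
[cite: DimockYuan2024GNFlow, proof of Thm 4 (arXiv:2303.07916v3 TeX ll. 4073–4076)] -/
theorem lipBackground_of_analyticMargin {EA : Functional C C.BgA} {W : Set (ℕ → ℝ)} {κ E₀ : ℝ}
    (ι : C.BgA → E) (D : (ℕ → ℝ) → C.Dom → Set E) (ϱ : (ℕ → ℝ) → ℕ → ℝ) (Ec : (ℕ → ℝ) → C.Dom → E → ℂ)
    (hϱ : ∀ g ∈ W, ∀ j, 0 < ϱ g j)
    (hhol : ∀ g ∈ W, ∀ X : C.Dom, DifferentiableOn ℂ (Ec g X) (D g X))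
    (hbd : ∀ g ∈ W, ∀ X : C.Dom, ∀ z ∈ D g X, ‖Ec g X z‖ ≤ E₀ * Real.exp (-(κ * C.d X)))
    (hmargin : ∀ g ∈ W, ∀ (X : C.Dom) (U : C.BgA), closedBall (ι U) (ϱ g (C.scale X)) ⊆ D g X)
    (hreal : ∀ g ∈ W, ∀ (X : C.Dom) (U : C.BgA), Ec g X (ι U) = (EA g U X : ℂ))
    (hgauge : ∀ U U' : C.BgA, ‖ι U - ι U'‖ ≤ C.gauge U U') :
    LipBackground EA W κ (fun g j => 4 * E₀ / ϱ g j) := by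
  intro g hg U U' X
  have hS : ∀ y ∈ Set.range ι, closedBall y (ϱ g (C.scale X)) ⊆ D g X := by
    rintro _ ⟨U'', rfl⟩
    exact hmargin g hg X U''
  have h := Dimock2015.norm_sub_le_of_margin (hϱ g hg (C.scale X)) (hhol g hg X) (hbd g hg X) hS
    (Set.mem_range_self U) (Set.mem_range_self U')
  rw [hreal g hg X U, hreal g hg X U', ← Complex.ofReal_sub, Complex.norm_real, Real.norm_eq_abs] at h
  have hM0 : 0 ≤ E₀ * Real.exp (-(κ * C.d X)) :=
    (norm_nonneg _).trans (hbd g hg X _ (hmargin g hg X U (mem_closedBall_self (hϱ g hg _).le)))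
  have hK : 0 ≤ 4 * (E₀ * Real.exp (-(κ * C.d X))) / ϱ g (C.scale X) :=
    div_nonneg (mul_nonneg (by norm_num) hM0) (hϱ g hg _).le
  calc |EA g U X - EA g U' X|
      ≤ 4 * (E₀ * Real.exp (-(κ * C.d X))) / ϱ g (C.scale X) * ‖ι U - ι U'‖ := h
    _ ≤ 4 * (E₀ * Real.exp (-(κ * C.d X))) / ϱ g (C.scale X) * C.gauge U U' :=
        mul_le_mul_of_nonneg_left (hgauge U U') hK
    _ = 4 * E₀ / ϱ g (C.scale X) * Real.exp (-(κ * C.d X)) * C.gauge U U' := by ring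

omit [NormedSpace ℂ E] in
/-- The sup bound on the extension already gives the printed-form decay bound `T4OutputRate.DecayBound EA W E₀ κ` of the
real values ((I.1.18); bookkeeping: the real backgrounds are centres of balls inside the domain). [folklore] -/
theorem decayBound_of_analyticMargin {EA : Functional C C.BgA} {W : Set (ℕ → ℝ)} {κ E₀ : ℝ}
    (ι : C.BgA → E) (D : (ℕ → ℝ) → C.Dom → Set E) (ϱ : (ℕ → ℝ) → ℕ → ℝ) (Ec : (ℕ → ℝ) → C.Dom → E → ℂ)
    (hϱ : ∀ g ∈ W, ∀ j, 0 < ϱ g j)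
    (hbd : ∀ g ∈ W, ∀ X : C.Dom, ∀ z ∈ D g X, ‖Ec g X z‖ ≤ E₀ * Real.exp (-(κ * C.d X)))
    (hmargin : ∀ g ∈ W, ∀ (X : C.Dom) (U : C.BgA), closedBall (ι U) (ϱ g (C.scale X)) ⊆ D g X)
    (hreal : ∀ g ∈ W, ∀ (X : C.Dom) (U : C.BgA), Ec g X (ι U) = (EA g U X : ℂ)) :
    DecayBound EA W E₀ κ := by
  intro g hg U X
  have h := hbd g hg X _ (hmargin g hg X U (mem_closedBall_self (hϱ g hg _).le))
  rwa [hreal g hg X U, Complex.norm_real, Real.norm_eq_abs] at h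

end Cauchy

/-! ## §2 The margin in coupling units: (2.28) and (0.31) ⇒ `PolyLipGrowth` with exponent `1` -/

/-- THE PRINTED RADIUS SHAPE IS AT LEAST LINEAR IN THE COUPLING: `α = g_j·C·(log g_j^{−2})^q ≥ C·g_j` once
`g_j² ≤ e^{−1}` (then `log g_j^{−2} ≥ 1`), for `C ≥ 0`, `g_j > 0` — over the tree's `B14.alphaJ` ((2.28) p. 259 of
[Balaban1988Convergent], verbatim there).  The logarithm only enlarges the radius; §2 keeps the factor `g_j` alone. [folklore] -/
theorem alphaJ_ge_mul {Cc gj : ℝ} (q : ℕ) (hC : 0 ≤ Cc) (hg : 0 < gj) (hsmall : gj ^ 2 ≤ Real.exp (-1)) :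
    Cc * gj ≤ B14.alphaJ Cc q gj := by
  unfold B14.alphaJ
  have hpos : 0 < gj ^ 2 := by positivity
  have hlog : 1 ≤ Real.log (gj ^ 2)⁻¹ := by
    rw [Real.log_inv]
    have h := Real.log_le_log hpos hsmall
    rw [Real.log_exp] at h
    linarith
  have hpow : 1 ≤ (Real.log (gj ^ 2)⁻¹) ^ q := one_le_pow₀ hlog
  calc Cc * gj = gj * Cc * 1 := by ring
    _ ≤ gj * Cc * (Real.log (gj ^ 2)⁻¹) ^ q := mul_le_mul_of_nonneg_left hpow (mul_nonneg hg.le hC)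

/-- THE MARGIN READING (MR) — NOT PRINTED, the shape used in §2: "the analyticity margin `ϱ(g, j)` of the scale-`j`
regular terms about the admissible real backgrounds, in the complex space of background data of §1, is `≥ c₀·g_j` for
every admissible coupling sequence `g` of the window", i.e. `∀ g ∈ W, ∀ j, c₀·g j ≤ ϱ g j`.  Print gives the radii (2.28)
of the SPACE `U^c_j(X, α_{0,j}, α_{1,j})` (one run) and the membership (I.1.17) of the real configurations; a quantitative
margin is the cell's reading (GAPS G-t4-U3-2), not a printed statement.  THIS LEMMA: the printed radii themselves, as a
margin family `ϱ g j = α(C, q, g_j)` (tree `B14.alphaJ`), satisfy (MR) with `c₀ = C` on any window `]0, γ]^ℕ` with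
`γ² ≤ e^{−1}`. [cite: Balaban1988Convergent, (2.27)-(2.28) p.259] -/
theorem couplingMargin_alphaJ {Cc γ : ℝ} (q : ℕ) (hC : 0 ≤ Cc) (hγ : γ ^ 2 ≤ Real.exp (-1)) :
    ∀ g ∈ Window γ, ∀ j : ℕ, Cc * g j ≤ (fun g j => B14.alphaJ Cc q (g j)) g j := by
  intro g hg j
  obtain ⟨h0, hγ'⟩ := hg j
  exact alphaJ_ge_mul q hC h0 ((pow_le_pow_left₀ h0.le hγ' 2).trans hγ)

/-- THE ARITHMETIC OF THE GROWTH: `1/x² ≤ 1/g² + β′n` with `x, g > 0`, `β′, n ≥ 0` gives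
`1/x ≤ (1/g + √β′)(n + 1)` (square both sides: `(1/g + √β′)² ≥ 1/g² + β′` and `(n+1)² ≥ n + 1`). [folklore] -/
theorem inv_le_of_invSq_le {x g β' n : ℝ} (hx : 0 < x) (hg : 0 < g) (hβ' : 0 ≤ β') (hn : 0 ≤ n)
    (h : 1 / x ^ 2 ≤ 1 / g ^ 2 + β' * n) : 1 / x ≤ (1 / g + Real.sqrt β') * (n + 1) := by
  have hs0 : 0 ≤ Real.sqrt β' := Real.sqrt_nonneg _
  have hA0 : 0 ≤ 1 / g := by positivity
  have hL : 0 ≤ 1 / x := by positivity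
  have hR : 0 ≤ (1 / g + Real.sqrt β') * (n + 1) := by positivity
  rw [← pow_le_pow_iff_left₀ hL hR two_ne_zero]
  have hsq : Real.sqrt β' ^ 2 = β' := Real.sq_sqrt hβ'
  have h1 : (1 / x) ^ 2 = 1 / x ^ 2 := by rw [div_pow, one_pow]
  have step1 : 1 / g ^ 2 + β' ≤ (1 / g + Real.sqrt β') ^ 2 := by
    have e : (1 / g + Real.sqrt β') ^ 2 = 1 / g ^ 2 + 2 * (1 / g * Real.sqrt β') + Real.sqrt β' ^ 2 := by ring
    rw [e, hsq]
    nlinarith [mul_nonneg hA0 hs0]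
  have step2 : n + 1 ≤ (n + 1) ^ 2 := by nlinarith
  have step3 : 1 / g ^ 2 + β' * n ≤ (1 / g ^ 2 + β') * (n + 1) := by
    nlinarith [mul_nonneg hβ' hn, one_div_nonneg.mpr (sq_nonneg g)]
  rw [h1]
  calc 1 / x ^ 2 ≤ 1 / g ^ 2 + β' * n := h
    _ ≤ (1 / g ^ 2 + β') * (n + 1) := step3
    _ ≤ (1 / g + Real.sqrt β') ^ 2 * (n + 1) ^ 2 :=
        mul_le_mul step1 step2 (by positivity) (by positivity)
    _ = ((1 / g + Real.sqrt β') * (n + 1)) ^ 2 := by ring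

/-- THE UPPER HALF OF (0.31) p. 259 of [Balaban1987RG1] (tree `Step.Discrete031`, two-sided; `g` = the renormalized
coupling): `1/g_j² ≤ 1/g² + β′(K − j)` for `j ≤ K` — the inverse squared coupling grows at most LINEARLY in the number of
remaining steps.  Only this half is used below. [cite: Balaban1987RG1, (0.31) p.259] -/
theorem invSq_le_of_discrete031 {b β' g : ℝ} {K : ℕ} {gs : ℕ → ℝ} (h : Step.Discrete031 b β' K g gs) {j : ℕ}
    (hj : j ≤ K) : 1 / gs j ^ 2 ≤ 1 / g ^ 2 + β' * ((K : ℝ) - j) :=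
  (h j hj).2

/-- THE SAME FROM THE PRINTED FLOW INEQUALITY (2.6) p. 255 of [Balaban1988Convergent] (tree `B14.FlowIneq26`, its first
member `g_n ≤ (1 + g_n²β′(n − m))^{1/2} g_m`, with `n = K` the infrared end): squaring, `1/g_j² ≤ 1/g_K² + β′(K − j)` for
`j ≤ K` and positive couplings.  ((2.6) is printed as a consequence of (0.20) and "the properties of the β-functions" —
the cell's police rule P7: it carries the same conditional as (0.31).) [cite: Balaban1988Convergent, (2.6) p.255] -/
theorem invSq_le_of_flowIneq26 {g : ℕ → ℝ} {β' β₀ : ℝ} {K : ℕ} (h : B14.FlowIneq26 g β' β₀ K)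
    (hpos : ∀ i ≤ K, 0 < g i) (hβ' : 0 ≤ β') {j : ℕ} (hj : j ≤ K) :
    1 / g j ^ 2 ≤ 1 / g K ^ 2 + β' * ((K : ℝ) - j) := by
  rcases Nat.lt_or_eq_of_le hj with hjK | rfl
  · obtain ⟨h1, -⟩ := h j K hjK le_rfl
    have ha := hpos K le_rfl
    have hb := hpos j hj
    have hn : 0 ≤ (K : ℝ) - j := by
      have : (j : ℝ) ≤ K := by exact_mod_cast hj
      linarith
    have hc0 : 0 ≤ 1 + g K ^ 2 * β' * ((K : ℝ) - j) := by positivity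
    have hsq : g K ^ 2 ≤ (1 + g K ^ 2 * β' * ((K : ℝ) - j)) * g j ^ 2 := by
      have h2 := pow_le_pow_left₀ ha.le h1 2
      rwa [mul_pow, Real.sq_sqrt hc0] at h2
    rw [div_le_iff₀ (by positivity : (0 : ℝ) < g j ^ 2)]
    have hK2 : (0 : ℝ) < g K ^ 2 := by positivity
    calc (1 : ℝ) = g K ^ 2 / g K ^ 2 := (div_self hK2.ne').symm
      _ ≤ (1 + g K ^ 2 * β' * ((K : ℝ) - j)) * g j ^ 2 / g K ^ 2 := div_le_div_of_nonneg_right hsq hK2.le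
      _ = (1 / g K ^ 2 + β' * ((K : ℝ) - j)) * g j ^ 2 := by
          field_simp
  · simp

/-- **THE LIPSCHITZ-IN-U CONSTANT GROWS AT MOST LINEARLY IN THE REMAINING SCALES.**  The margin reading (MR)
`ϱ(g, j) ≥ c₀g_j` on the window (NOT PRINTED, see `couplingMargin_alphaJ`), run A's re-indexed coupling sequences `g K ∈ W`, positive up to the cutoff, with
inverse squares growing at most linearly from the renormalized coupling `gIR` (`1/g_{K,j}² ≤ 1/gIR² + β′(K − j)`: the upper
half of (0.31), `invSq_le_of_discrete031`, or (2.6), `invSq_le_of_flowIneq26` with the infrared pin `g K K = gIR`), give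
`T4TowerRateComposition.PolyLipGrowth` for the constant family `4E₀/ϱ` of §1 with exponent `1` and the explicit constant
`(4E₀/c₀)(1/gIR + √β′)` — the hypothesis (M3′) of the record `t4/T4-EST-NE7-P1.md`, reduced to the margin reading. [folklore] -/
theorem polyLipGrowth_of_couplingMargin {ϱ : (ℕ → ℝ) → ℕ → ℝ} {W : Set (ℕ → ℝ)} {c₀ E₀ β' gIR : ℝ}
    {gA : ℕ → ℕ → ℝ} (hm : ∀ g ∈ W, ∀ j : ℕ, c₀ * g j ≤ ϱ g j) (hc₀ : 0 < c₀) (hE₀ : 0 ≤ E₀) (hgA : ∀ K, gA K ∈ W)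
    (hpos : ∀ K j, j ≤ K → 0 < gA K j)
    (hup : ∀ K j, j ≤ K → 1 / gA K j ^ 2 ≤ 1 / gIR ^ 2 + β' * ((K : ℝ) - j)) (hgIR : 0 < gIR) (hβ' : 0 ≤ β') :
    PolyLipGrowth (fun g j => 4 * E₀ / ϱ g j) gA (4 * E₀ / c₀ * (1 / gIR + Real.sqrt β')) 1 := by
  intro K j hj
  have hg := hpos K j hj
  have hϱ : 0 < ϱ (gA K) j := lt_of_lt_of_le (mul_pos hc₀ hg) (hm (gA K) (hgA K) j)
  refine ⟨div_nonneg (by positivity) hϱ.le, ?_⟩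
  have hKj : ((K : ℝ) - j) = ((K - j : ℕ) : ℝ) := by push_cast [Nat.cast_sub hj]; ring
  have hup' := hup K j hj
  rw [hKj] at hup'
  have hinv := inv_le_of_invSq_le hg hgIR hβ' (Nat.cast_nonneg _) hup'
  rw [pow_one]
  calc 4 * E₀ / ϱ (gA K) j ≤ 4 * E₀ / (c₀ * gA K j) :=
        div_le_div_of_nonneg_left (by positivity) (mul_pos hc₀ hg) (hm (gA K) (hgA K) j)
    _ = 4 * E₀ / c₀ * (1 / gA K j) := by
        field_simp
    _ ≤ 4 * E₀ / c₀ * ((1 / gIR + Real.sqrt β') * (((K - j : ℕ) : ℝ) + 1)) :=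
        mul_le_mul_of_nonneg_left hinv (by positivity)
    _ = 4 * E₀ / c₀ * (1 / gIR + Real.sqrt β') * (((K - j : ℕ) : ℝ) + 1) := by ring

/-- The cell-standard instance: (0.31) at every cutoff (`∀ K, Step.Discrete031 b β′ K gIR (gA K)`, as consumed by
`T4TowerRateComposition.summable_crossoverDeltaPoly`) supplies `hup`. [folklore] -/
theorem polyLipGrowth_of_couplingMargin_discrete031 {ϱ : (ℕ → ℝ) → ℕ → ℝ} {W : Set (ℕ → ℝ)} {c₀ E₀ b β' gIR : ℝ}
    {gA : ℕ → ℕ → ℝ} (hm : ∀ g ∈ W, ∀ j : ℕ, c₀ * g j ≤ ϱ g j) (hc₀ : 0 < c₀) (hE₀ : 0 ≤ E₀) (hgA : ∀ K, gA K ∈ W)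
    (hpos : ∀ K j, j ≤ K → 0 < gA K j) (h031 : ∀ K, Step.Discrete031 b β' K gIR (gA K)) (hgIR : 0 < gIR)
    (hβ' : 0 ≤ β') :
    PolyLipGrowth (fun g j => 4 * E₀ / ϱ g j) gA (4 * E₀ / c₀ * (1 / gIR + Real.sqrt β')) 1 :=
  polyLipGrowth_of_couplingMargin hm hc₀ hE₀ hgA hpos (fun K _ hj => invSq_le_of_discrete031 (h031 K) hj) hgIR hβ'

/-- The printed-flow instance: (2.6) at every cutoff with the infrared pin `g K K = gIR` supplies `hup`. [folklore] -/
theorem polyLipGrowth_of_couplingMargin_flowIneq26 {ϱ : (ℕ → ℝ) → ℕ → ℝ} {W : Set (ℕ → ℝ)} {c₀ E₀ β' β₀ gIR : ℝ}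
    {gA : ℕ → ℕ → ℝ} (hm : ∀ g ∈ W, ∀ j : ℕ, c₀ * g j ≤ ϱ g j) (hc₀ : 0 < c₀) (hE₀ : 0 ≤ E₀) (hgA : ∀ K, gA K ∈ W)
    (hpos : ∀ K j, j ≤ K → 0 < gA K j) (h26 : ∀ K, B14.FlowIneq26 (gA K) β' β₀ K) (hpin : ∀ K, gA K K = gIR)
    (hgIR : 0 < gIR) (hβ' : 0 ≤ β') :
    PolyLipGrowth (fun g j => 4 * E₀ / ϱ g j) gA (4 * E₀ / c₀ * (1 / gIR + Real.sqrt β')) 1 :=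
  polyLipGrowth_of_couplingMargin hm hc₀ hE₀ hgA hpos
    (fun K j hj => by rw [← hpin K]; exact invSq_le_of_flowIneq26 (h26 K) (hpos K) hβ' hj) hgIR hβ'

/-! ## §3 No order among the rates: everything worsened to a common rate, constants uniform in the cutoff -/

section Tower

variable {C : Carriers} {V : Type*}

/-- NE5 can be WORSENED in the rate: `NE5 … θ C₅` with `0 ≤ θ ≤ θ′`, `0 ≤ C₅` gives `NE5 … θ′ C₅`. [folklore] -/
theorem ne5_mono {EA : Functional C C.BgA} {EB : Functional C C.BgB} {W : Set (ℕ → ℝ)} {κ θ θ' C₅ : ℝ}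
    (h : NE5 EA EB W κ θ C₅) (hθ : 0 ≤ θ) (hθθ' : θ ≤ θ') (hC₅ : 0 ≤ C₅) : NE5 EA EB W κ θ' C₅ :=
  fun g hg U X => (h g hg U X).trans (mul_le_mul_of_nonneg_right
    (mul_le_mul_of_nonneg_left (pow_le_pow_left₀ hθ hθθ' _) hC₅) (Real.exp_pos _).le)

/-- **NODE U3 ALONG THE TOWER AT ANY COMMON WORSE RATE.**  The hypotheses of
`T4TowerRateComposition.uRateUpTo_tower` with FOUR INDEPENDENT RATES — fading memory `ω`, node U2's coupling rate `θc`,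
the composed argument bracket `CU·δc K ≤ aθa^j`, NE5's `θ₅` — and ANY `θ′` with `max(ω, θc) < θ′`, `θa ≤ θ′`, `θ₅ ≤ θ′`
give, FOR EVERY CUTOFF `K`, `URateUpTo K` at rate `θ′` with the `K`-INDEPENDENT constant
`a + C₉D·θ′/(θ′ − max(ω,θc)) + C₅`.  No order among `ω`, `θc`, `θa`, `θ₅` is assumed. [folklore] -/
theorem uRateUpTo_tower_anyRate {W : Set (ℕ → ℝ)} {EA : Functional C C.BgA} {EB : Functional C C.BgB}
    {κ θ₅ C₅ C₉ ω θc D a θa θ' : ℝ} {Λ : ℕ → ℕ → ℝ} {CU : (ℕ → ℝ) → ℕ → ℝ}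
    (h9 : NE9 EA W κ Λ) (hΛ : FadingMemory C₉ ω Λ) (hU : LipBackground EA W κ CU) (h5 : NE5 EA EB W κ θ₅ C₅)
    (hω : 0 ≤ ω) (hθc : 0 ≤ θc) (hθ₅ : 0 ≤ θ₅) (hθa : 0 ≤ θa) (hC₅ : 0 ≤ C₅) (hD : 0 ≤ D) (ha0 : 0 ≤ a)
    (hθ' : max ω θc < θ') (hθ₅' : θ₅ ≤ θ') (hθa' : θa ≤ θ')
    {gA gB : ℕ → ℕ → ℝ} (hgA : ∀ K, gA K ∈ W) (hgB : ∀ K, gB K ∈ W)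
    (hcoup : ∀ K i, i ≤ K → |gA K i - gB K i| ≤ D * θc ^ i)
    {uA : ℕ → V → C.BgA} {uB : ℕ → V → C.BgB} {Adm : ℕ → Set V} {δc : ℕ → ℝ}
    (hclose : ∀ K, ∀ v ∈ Adm K, C.gauge (uA K v) (C.transport (uB K v)) ≤ δc K)
    (hCU : ∀ K j, j ≤ K → 0 ≤ CU (gA K) j) (harg : ∀ K j, j ≤ K → CU (gA K) j * δc K ≤ a * θa ^ j) (K : ℕ) :
    URateUpTo K EA EB (gA K) (gB K) (uA K) (uB K) (Adm K) (a + C₉ * D * (θ' / (θ' - max ω θc)) + C₅) θ' κ := by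
  refine uRateUpTo_of_brackets h9 hU (ne5_mono h5 hθ₅ hθ₅' hC₅) (hgA K) (hgB K) (hclose K) (hCU K) ?_ ?_
  · intro j hj
    exact (harg K j hj).trans (mul_le_mul_of_nonneg_left (pow_le_pow_left₀ hθa hθa' j) ha0)
  · intro j _
    exact historySum_le_rate_of_lt hΛ hω hθc hD hθ' fun i hi => hcoup K i (by omega)

/-- A COMMON RATE BELOW ONE ALWAYS EXISTS: if `ω, θc, θ₃, θ₅ < 1` then some `θ′ < 1` has `max(ω, θc) < θ′`, `θ₃ ≤ θ′`,
`θ₅ ≤ θ′` — so §5–§6 of `T4TowerRateComposition`, which need only SOME rate in `(0, 1)`, always apply to the output of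
`uRateUpTo_tower_anyRate` / §4 (and `θ′ > max(ω, θc) ≥ 0`). [folklore] -/
theorem exists_commonRate_lt_one {ω θc θ₃ θ₅ : ℝ} (hω : ω < 1) (hθc : θc < 1) (hθ₃ : θ₃ < 1) (hθ₅ : θ₅ < 1) :
    ∃ θ' : ℝ, max ω θc < θ' ∧ θ₃ ≤ θ' ∧ θ₅ ≤ θ' ∧ θ' < 1 := by
  obtain ⟨θ', h1, h2⟩ := exists_between (show max (max ω θc) (max θ₃ θ₅) < 1 from
    max_lt (max_lt hω hθc) (max_lt hθ₃ hθ₅))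
  exact ⟨θ', lt_of_le_of_lt (le_max_left _ _) h1, ((le_max_left _ _).trans (le_max_right _ _)).trans h1.le,
    ((le_max_right _ _).trans (le_max_right _ _)).trans h1.le, h2⟩

end Tower

/-! ## §4 The seams by name, and the end-to-end composition -/

section Spine

/-- Node U2's module restates fading memory verbatim; the two shapes are the same proposition. [folklore] -/
theorem fadingMemory_iff (C₉ ω : ℝ) (Λ : ℕ → ℕ → ℝ) :
    T4CouplingMatching.FadingMemory C₉ ω Λ ↔ T4OutputRate.FadingMemory C₉ ω Λ := Iff.rfl

variable {C : Carriers} {ι X : Type}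

/-- **THE SEAM TO NODE U1b/NE3 BY NAME.**  NE3 in the minimal η-rate currency (`T4EtaRateMin.LocalRate R C₃ θ₃`: the local
readings of the `k`-step and `(k+1)`-step runs differ by `≤ C₃θ₃^k`, NOT PRINTED) and the liaison
`T4RateLiaison.GaugeDominated R uA uB` (run A's gauge between the cutoff-`K` backgrounds is dominated by the discrepancy of
the local readings) give the closeness `C₃θ₃^K` of the two runs' backgrounds at every cutoff, on the admissible data
`R.dom` — the `hclose`/`δc` input of §3 (`T4RateLiaison.gauge_le_of_localRate`, bundled over `K`). [folklore] -/
theorem closeness_of_localRate {R : Readings ι X} {C₃ θ₃ : ℝ} (hloc : LocalRate R C₃ θ₃)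
    {uA : ℕ → ι → C.BgA} {uB : ℕ → ι → C.BgB} (hgd : GaugeDominated R uA uB) :
    ∀ K, ∀ v ∈ R.dom, C.gauge (uA K v) (C.transport (uB K v)) ≤ C₃ * θ₃ ^ K :=
  fun K _ hv => gauge_le_of_localRate hloc hgd K hv

/-- A nonnegativity read off the printed box at the origin. [folklore] -/
theorem box_nonneg {γ : ℝ} {g : ℕ → ℕ → ℝ} (hbox : ∀ K i, i ≤ K → 0 < g K i ∧ g K i ≤ γ) : 0 ≤ γ :=
  (hbox 0 0 le_rfl).1.le.trans (hbox 0 0 le_rfl).2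

/-- **TERM-WISE MATCHING FROM THE SIBLING NODES' TYPED OUTPUTS (end to end, `K`-uniform constant).**  Hypotheses, all BY
NAME and none printed: node U3's shapes on a window `W` — `NE9 EA W κ Λ` with `FadingMemory C₉ ω Λ`, `LipBackground EA W κ
CU` with `PolyLipGrowth CU g P q` (§1–§2 produce them from the margin reading), `NE5 EA EB W κ θ₅ C₅`; node U1b/NE3 as
`LocalRate R C₃ θ₃` (`θ₃ < 1`) with the liaison `GaugeDominated R uA uB`; node U2's OUTPUT `InjectedRate Cd 0 θc disc` for
the tower table `g` of re-indexed couplings on the printed box `]0, γ]`; both runs' sequences in `W`.  Conclusion: for ANY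
`θ′` with `max(ω, θc) < θ′`, `θ₅, θ₃ ≤ θ′` there is ONE `a ≥ 0` such that FOR EVERY CUTOFF `K` the node-U3 rate
`URateUpTo K` holds between run A (`g K`, `uA K`) and run B (`i ↦ g (K+1) (i+1)`, `uB K`) on `R.dom` with constant
`a + C₉(γ³Cd)·θ′/(θ′ − max(ω,θc)) + C₅` and rate `θ′`. [folklore] -/
theorem uRateUpTo_of_nodes {R : Readings ι X} {W : Set (ℕ → ℝ)} {EA : Functional C C.BgA} {EB : Functional C C.BgB}
    {κ θ₅ C₅ C₉ ω θc Cd γ C₃ θ₃ P θ' : ℝ} {q : ℕ} {Λ : ℕ → ℕ → ℝ} {CU : (ℕ → ℝ) → ℕ → ℝ} {g : ℕ → ℕ → ℝ}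
    {uA : ℕ → ι → C.BgA} {uB : ℕ → ι → C.BgB}
    (h9 : NE9 EA W κ Λ) (hΛ : FadingMemory C₉ ω Λ) (hω : 0 ≤ ω)
    (hU : LipBackground EA W κ CU) (hG : PolyLipGrowth CU g P q) (hP : 0 ≤ P)
    (h5 : NE5 EA EB W κ θ₅ C₅) (hθ₅ : 0 ≤ θ₅) (hC₅ : 0 ≤ C₅)
    (hloc : LocalRate R C₃ θ₃) (hC₃ : 0 ≤ C₃) (hθ₃ : 0 ≤ θ₃) (hθ₃1 : θ₃ < 1) (hgd : GaugeDominated R uA uB)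
    (hinj : InjectedRate Cd 0 θc (fun K j => T4CouplingMatching.disc (g K) (g (K + 1)) j)) (hCd : 0 ≤ Cd)
    (hθc : 0 ≤ θc) (hbox : ∀ K i, i ≤ K → 0 < g K i ∧ g K i ≤ γ)
    (hgA : ∀ K, g K ∈ W) (hgB : ∀ K, (fun i => g (K + 1) (i + 1)) ∈ W)
    (hθ' : max ω θc < θ') (hθ₅' : θ₅ ≤ θ') (hθ₃' : θ₃ ≤ θ') :
    ∃ a : ℝ, 0 ≤ a ∧ ∀ K, URateUpTo K EA EB (g K) (fun i => g (K + 1) (i + 1)) (uA K) (uB K) R.dom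
      (a + C₉ * (γ ^ 3 * Cd) * (θ' / (θ' - max ω θc)) + C₅) θ' κ := by
  have hclose := closeness_of_localRate (C := C) hloc hgd
  obtain ⟨a, ha0, harg⟩ := argBracket_tower (δc := fun K => C₃ * θ₃ ^ K) hG hP hC₃ hθ₃ hθ₃1 hθ₃'
    (fun K => by positivity) (fun K => le_rfl)
  have hD : 0 ≤ γ ^ 3 * Cd := mul_nonneg (pow_nonneg (box_nonneg hbox) 3) hCd
  refine ⟨a, ha0, fun K => ?_⟩
  exact uRateUpTo_tower_anyRate (gB := fun K i => g (K + 1) (i + 1)) (Adm := fun _ => R.dom)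
    (δc := fun K => C₃ * θ₃ ^ K) h9 hΛ hU h5 hω hθc hθ₅ (hθ₃.trans hθ₃') hC₅ hD ha0 hθ' hθ₅' le_rfl hgA hgB
    (fun K i hi => couplingRate_pair_of_injectedDisc hinj hbox K i hi) hclose (fun K j hj => (hG K j hj).1) harg K

open FlowStep T4CouplingMatching in
/-- **TERM-WISE MATCHING FROM THE SPINE'S INPUTS (node U2 unfolded to its hypotheses).**  As `uRateUpTo_of_nodes`, with
node U2's output REPLACED by the inputs of `T4CouplingMatching.injectedRate_of_runs_eventual`: the RG equations (0.20)
with history-dependent β-functions at every cutoff (`RGEqH K β (g K)`), the printed box `]0, γ]`, the infrared pin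
`g K K = gIR`, NE4 = `ScaleShiftRate c θc γ β`, NE9-β = `HistLipschitz Λβ γ β` with `FadingMemory Cβ θc Λβ`, the
ASYMPTOTIC-FREEDOM LOWER BOUND `EventualLowerH b γ k₀ β` (β-functions `≥ b > 0` on the box from scale `k₀` on — NOT
PRINTED: [Balaban1989LargeFieldII] p. 355 says the β-function paper "has not been published yet"; in the cell it is what
the β sub-cell's OPEN analytic inputs (AF-0r)/(AF-0∞)/(AF-1) deliver on the BetaPertH road, i.e. the conditional behind
(0.31) — here an explicit binder, as in `T4CouplingMatching.EventualLowerH`'s docstring) and the smallness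
`Cβ((k₀+1)γ³ + 2γ/b) ≤ (1 − θc)/2`.  Conclusion: the same `K`-uniform
`URateUpTo K` with node U2's constant `Cd = 2c/(1 − θc)`. [folklore] -/
theorem uRateUpTo_of_spine {β : HBeta} {R : Readings ι X} {W : Set (ℕ → ℝ)} {EA : Functional C C.BgA}
    {EB : Functional C C.BgB} {κ θ₅ C₅ C₉ ω θc γ b c Cβ C₃ θ₃ P θ' : ℝ} {q k₀ : ℕ} {Λ Λβ : ℕ → ℕ → ℝ}
    {CU : (ℕ → ℝ) → ℕ → ℝ} {g : ℕ → ℕ → ℝ} {uA : ℕ → ι → C.BgA} {uB : ℕ → ι → C.BgB} (gIR : ℝ)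
    (h9 : NE9 EA W κ Λ) (hΛ : T4OutputRate.FadingMemory C₉ ω Λ) (hω : 0 ≤ ω)
    (hU : LipBackground EA W κ CU) (hG : PolyLipGrowth CU g P q) (hP : 0 ≤ P)
    (h5 : NE5 EA EB W κ θ₅ C₅) (hθ₅ : 0 ≤ θ₅) (hC₅ : 0 ≤ C₅)
    (hloc : LocalRate R C₃ θ₃) (hC₃ : 0 ≤ C₃) (hθ₃ : 0 ≤ θ₃) (hθ₃1 : θ₃ < 1) (hgd : GaugeDominated R uA uB)
    (hγ : 0 < γ) (hb : 0 < b) (hθc0 : 0 < θc) (hθc1 : θc < 1) (hc : 0 ≤ c) (hCβ : 0 ≤ Cβ)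
    (hrun : ∀ K, RGEqH K β (g K)) (hbox : ∀ K i, i ≤ K → 0 < g K i ∧ g K i ≤ γ) (hpin : ∀ K, g K K = gIR)
    (hS : ScaleShiftRate c θc γ β) (hL : HistLipschitz Λβ γ β) (hΛβ : T4CouplingMatching.FadingMemory Cβ θc Λβ)
    (hlo : EventualLowerH b γ k₀ β) (hsmall : Cβ * (((k₀ : ℝ) + 1) * γ ^ 3 + 2 * γ / b) ≤ (1 - θc) / 2)
    (hgA : ∀ K, g K ∈ W) (hgB : ∀ K, (fun i => g (K + 1) (i + 1)) ∈ W)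
    (hθ' : max ω θc < θ') (hθ₅' : θ₅ ≤ θ') (hθ₃' : θ₃ ≤ θ') :
    ∃ a : ℝ, 0 ≤ a ∧ ∀ K, URateUpTo K EA EB (g K) (fun i => g (K + 1) (i + 1)) (uA K) (uB K) R.dom
      (a + C₉ * (γ ^ 3 * (2 * c / (1 - θc))) * (θ' / (θ' - max ω θc)) + C₅) θ' κ :=
  uRateUpTo_of_nodes h9 hΛ hω hU hG hP h5 hθ₅ hC₅ hloc hC₃ hθ₃ hθ₃1 hgd
    (injectedRate_of_runs_eventual g gIR hγ hb hθc0 hθc1 hc hCβ hrun hbox hpin hS hL hΛβ hlo hsmall)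
    (div_nonneg (mul_nonneg zero_le_two hc) (by linarith)) hθc0.le hbox hgA hgB hθ' hθ₅' hθ₃'

/-- **THE FULLY LOCATED TERM-WISE CHAIN** (margin reading in, `URateUpTo` out): §1's analytic-margin data for the regular
terms with sup constant `E₀ ≥ 0`, §2's margin in coupling units `c₀ > 0` and (0.31) at every cutoff with renormalized
coupling `gIR > 0`, and the remaining node shapes of `uRateUpTo_of_nodes`.  The Lipschitz-in-U family is then
`4E₀/ϱ`, its growth linear, and the conclusion is `uRateUpTo_of_nodes`'s. [folklore] -/
theorem uRateUpTo_of_margin {E : Type*} [NormedAddCommGroup E] [NormedSpace ℂ E] {R : Readings ι X} {W : Set (ℕ → ℝ)}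
    {EA : Functional C C.BgA} {EB : Functional C C.BgB} {κ E₀ c₀ b β' gIR θ₅ C₅ C₉ ω θc Cd γ C₃ θ₃ θ' : ℝ}
    {Λ : ℕ → ℕ → ℝ} {g : ℕ → ℕ → ℝ} {uA : ℕ → ι → C.BgA} {uB : ℕ → ι → C.BgB}
    (ιE : C.BgA → E) (D : (ℕ → ℝ) → C.Dom → Set E) (ϱ : (ℕ → ℝ) → ℕ → ℝ) (Ec : (ℕ → ℝ) → C.Dom → E → ℂ)
    (hϱ : ∀ g ∈ W, ∀ j, 0 < ϱ g j)
    (hhol : ∀ g ∈ W, ∀ X : C.Dom, DifferentiableOn ℂ (Ec g X) (D g X))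
    (hbd : ∀ g ∈ W, ∀ X : C.Dom, ∀ z ∈ D g X, ‖Ec g X z‖ ≤ E₀ * Real.exp (-(κ * C.d X)))
    (hmargin : ∀ g ∈ W, ∀ (X : C.Dom) (U : C.BgA), closedBall (ιE U) (ϱ g (C.scale X)) ⊆ D g X)
    (hreal : ∀ g ∈ W, ∀ (X : C.Dom) (U : C.BgA), Ec g X (ιE U) = (EA g U X : ℂ))
    (hgauge : ∀ U U' : C.BgA, ‖ιE U - ιE U'‖ ≤ C.gauge U U')
    (hE₀ : 0 ≤ E₀) (hm : ∀ g ∈ W, ∀ j : ℕ, c₀ * g j ≤ ϱ g j) (hc₀ : 0 < c₀)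
    (h031 : ∀ K, Step.Discrete031 b β' K gIR (g K)) (hgIR : 0 < gIR) (hβ' : 0 ≤ β')
    (h9 : NE9 EA W κ Λ) (hΛ : FadingMemory C₉ ω Λ) (hω : 0 ≤ ω)
    (h5 : NE5 EA EB W κ θ₅ C₅) (hθ₅ : 0 ≤ θ₅) (hC₅ : 0 ≤ C₅)
    (hloc : LocalRate R C₃ θ₃) (hC₃ : 0 ≤ C₃) (hθ₃ : 0 ≤ θ₃) (hθ₃1 : θ₃ < 1) (hgd : GaugeDominated R uA uB)
    (hinj : InjectedRate Cd 0 θc (fun K j => T4CouplingMatching.disc (g K) (g (K + 1)) j)) (hCd : 0 ≤ Cd)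
    (hθc : 0 ≤ θc) (hbox : ∀ K i, i ≤ K → 0 < g K i ∧ g K i ≤ γ)
    (hgA : ∀ K, g K ∈ W) (hgB : ∀ K, (fun i => g (K + 1) (i + 1)) ∈ W)
    (hθ' : max ω θc < θ') (hθ₅' : θ₅ ≤ θ') (hθ₃' : θ₃ ≤ θ') :
    ∃ a : ℝ, 0 ≤ a ∧ ∀ K, URateUpTo K EA EB (g K) (fun i => g (K + 1) (i + 1)) (uA K) (uB K) R.dom
      (a + C₉ * (γ ^ 3 * Cd) * (θ' / (θ' - max ω θc)) + C₅) θ' κ :=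
  uRateUpTo_of_nodes h9 hΛ hω (lipBackground_of_analyticMargin ιE D ϱ Ec hϱ hhol hbd hmargin hreal hgauge)
    (polyLipGrowth_of_couplingMargin_discrete031 (E₀ := E₀) hm hc₀ hE₀ hgA (fun K j hj => (hbox K j hj).1) h031
      hgIR hβ')
    (by positivity) h5 hθ₅ hC₅ hloc hC₃ hθ₃ hθ₃1 hgd hinj hCd hθc hbox hgA hgB hθ' hθ₅' hθ₃'

end Spine

/-! ## §5 The hook to node U5b with a cutoff-uniform constant (`p = 0`) -/

section Hook

variable {C : Carriers} {V : Type*}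

/-- THE NODE-U5b INSTANCE ON EVERY CUTOFF-`K` LEDGER WITH ONE CONSTANT: from `∀ K, URateUpTo K …` with a `K`-independent
`E₀′` (§4), `T4TowerRateComposition.factorLogRatio_smallFieldE_upTo` at every `K` for ledgers `fac K` of domains of scale
`≤ K`, with the SAME class constant `Ck smallFieldE = E₀′` for all `K`. [folklore] -/
theorem factorLogRatio_smallFieldE_tower {EA : Functional C C.BgA} {EB : Functional C C.BgB} {gA gB : ℕ → ℕ → ℝ}
    {uA : ℕ → V → C.BgA} {uB : ℕ → V → C.BgB} {Adm : Set V} {E₀' θ κ : ℝ}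
    (h : ∀ K, URateUpTo K EA EB (gA K) (gB K) (uA K) (uB K) Adm E₀' θ κ) (oneA : C.BgA) (oneB : C.BgB)
    (fac : ℕ → Finset C.Dom) (hfac : ∀ K, ∀ X ∈ fac K, C.scale X ≤ K) (Ck : T4RecentScale.Kind → ℝ)
    (hCk : Ck T4RecentScale.Kind.smallFieldE = E₀') (K : ℕ) :
    T4RecentScale.FactorLogRatio Adm (fac K) (fun _ => T4RecentScale.Kind.smallFieldE) C.scale
      (fun X => Real.exp (-(κ * C.d X)))
      (fun X v => Real.exp (EA (gA K) (uA K v) X - EA (gA K) oneA X))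
      (fun X v => Real.exp (EB (gB K) (uB K v) X - EB (gB K) oneB X))
      (fun X => -(EB (gB K) oneB X - EA (gA K) oneA X)) Ck θ (fun _ => 0) :=
  factorLogRatio_smallFieldE_upTo (h K) oneA oneB (fac K) (hfac K) Ck hCk

/-- With a `K`-uniform rate constant the polynomial profile of `T4TowerRateComposition` §5 is used with `p = 0`:
`crossoverDeltaPoly E a θ Λ R₁ C 0 … = T4Crossover.crossoverDelta (E + C) a θ Λ R₁ C …` — no polynomial loss at all is
incurred by the term-wise composition. [folklore] -/
theorem crossoverDeltaPoly_zero (E a θ Λ R₁ Cr : ℝ) (κ₀ : ℕ) (gs : ℕ → ℕ → ℝ) (w : ℕ → ℝ) (K : ℕ) :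
    crossoverDeltaPoly E a θ Λ R₁ Cr 0 κ₀ gs w K = T4Crossover.crossoverDelta (E + Cr) a θ Λ R₁ Cr κ₀ gs w K := by
  rw [crossoverDeltaPoly_eq, pow_zero, mul_one]

end Hook

/-! ## §6 Non-vacuity: toy readings, backgrounds and couplings meeting every hypothesis of `uRateUpTo_of_nodes` -/

section Toy

/-- **NON-VACUITY of §4's hypothesis set beyond `T4TowerRateComposition.toy_nonvacuous`** (toy data, no relation to
Bałaban's objects; written inline so that nothing is defined).  For `0 ≤ θ₃ ≤ 1` and `0 < γ`: the one-site readings with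
local reading `θ₃^k` of the `k`-step run satisfy NE3's shape `LocalRate … 1 θ₃`; the backgrounds `θ₃^K` (run A) and
`θ₃^{K+1}` (run B, identity transport) on `T4TowerRateComposition.toyCarriers` are `GaugeDominated` by them; the CONSTANT
coupling table `g K j = γ` lies in the box `]0, γ]` and has node-U2 discrepancy `disc = 0`, so `InjectedRate 0 0 θc disc`
for every `θc`; the constant Lipschitz family `CU ≡ 1` has `PolyLipGrowth … 1 0`. [folklore] -/
theorem toy_nodes_hypotheses {θ₃ γ θc : ℝ} (hθ₃0 : 0 ≤ θ₃) (hθ₃1 : θ₃ ≤ 1) (hγ : 0 < γ) :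
    LocalRate ({ dom := Set.univ, act := fun _ _ => 0, loc := fun k _ _ => θ₃ ^ k, vol := 0, vol_nonneg := le_rfl } :
        Readings Unit Unit) 1 θ₃ ∧
      GaugeDominated (Car := toyCarriers)
        ({ dom := Set.univ, act := fun _ _ => 0, loc := fun k _ _ => θ₃ ^ k, vol := 0, vol_nonneg := le_rfl } :
          Readings Unit Unit) (fun K _ => (θ₃ ^ K : ℝ)) (fun K _ => (θ₃ ^ (K + 1) : ℝ)) ∧
      InjectedRate 0 0 θc (fun K j => T4CouplingMatching.disc ((fun _ _ => γ : ℕ → ℕ → ℝ) K)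
        ((fun _ _ => γ : ℕ → ℕ → ℝ) (K + 1)) j) ∧
      (∀ K i : ℕ, i ≤ K → 0 < (fun _ _ => γ : ℕ → ℕ → ℝ) K i ∧ (fun _ _ => γ : ℕ → ℕ → ℝ) K i ≤ γ) ∧
      PolyLipGrowth (fun _ _ => (1 : ℝ)) (fun _ _ => γ) 1 0 := by
  refine ⟨?_, ?_, ?_, fun K i _ => ⟨hγ, le_rfl⟩, fun K j _ => ⟨zero_le_one, by simp⟩⟩
  · intro k V _ x
    show |θ₃ ^ (k + 1) - θ₃ ^ k| ≤ 1 * θ₃ ^ k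
    have e : θ₃ ^ (k + 1) - θ₃ ^ k = -(θ₃ ^ k * (1 - θ₃)) := by ring
    rw [e, abs_neg, abs_of_nonneg (mul_nonneg (pow_nonneg hθ₃0 k) (by linarith)), one_mul]
    exact mul_le_of_le_one_right (pow_nonneg hθ₃0 k) (by linarith)
  · intro K v _ M hM
    show |θ₃ ^ K - θ₃ ^ (K + 1)| ≤ M
    rw [abs_sub_comm]
    exact hM ()
  · intro K j _
    simp [T4CouplingMatching.disc]

/-- **THE CONCLUSION OF `uRateUpTo_of_nodes` ON THE TOY DATA** (so the theorem is not vacuous): with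
`T4TowerRateComposition.toyEA θ ω` / `toyEB θ ω C₅` (NE9, fading memory `C₉ = 1`, Lipschitz-in-U `CU ≡ 1`, NE5 at rate `θ`),
the toy readings/backgrounds/couplings of `toy_nodes_hypotheses` (with a GENUINE rate `θ₃ < 1` and all data admissible),
and any `θ′` with `max(ω, θc) < θ′`, `θ, θ₃ ≤ θ′`, the composed `URateUpTo K` holds at every cutoff with a `K`-uniform
constant. [folklore] -/
theorem toy_nodes_conclusion {θ ω C₅ θ₃ γ θc θ' : ℝ} (hθ0 : 0 ≤ θ) (hθ1 : θ ≤ 1) (hω : 0 ≤ ω) (hC₅ : 0 ≤ C₅)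
    (hθ₃0 : 0 ≤ θ₃) (hθ₃1 : θ₃ < 1) (hγ : 0 < γ) (hθc : 0 ≤ θc) (hθ' : max ω θc < θ') (hθθ' : θ ≤ θ')
    (hθ₃' : θ₃ ≤ θ') :
    ∃ a : ℝ, 0 ≤ a ∧ ∀ K, URateUpTo K (toyEA θ ω) (toyEB θ ω C₅) ((fun _ _ => γ : ℕ → ℕ → ℝ) K)
      (fun i => (fun _ _ => γ : ℕ → ℕ → ℝ) (K + 1) (i + 1)) ((fun K _ => (θ₃ ^ K : ℝ)) K)
      ((fun K _ => (θ₃ ^ (K + 1) : ℝ)) K) (Set.univ : Set Unit)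
      (a + 1 * (γ ^ 3 * 0) * (θ' / (θ' - max ω θc)) + C₅) θ' 0 := by
  obtain ⟨h9, hΛ, hU, h5⟩ := toy_nonvacuous hθ0 hθ1 hω hC₅
  obtain ⟨hloc, hgd, hinj, hbox, hG⟩ := toy_nodes_hypotheses (θc := θc) hθ₃0 hθ₃1.le hγ
  exact uRateUpTo_of_nodes (W := Set.univ) h9 hΛ hω hU hG zero_le_one h5 hθ0 hC₅ hloc zero_le_one hθ₃0 hθ₃1 hgd
    hinj le_rfl hθc hbox (fun _ => Set.mem_univ _) (fun _ => Set.mem_univ _) hθ' hθθ' hθ₃'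

end Toy

end Literature.MathematicalPhysics.QuantumFieldTheory.Balaban1983to89.T4TowerRateDischarge
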